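import Mathlib.Topology.MetricSpace.HausdorffDimension
import Mathlib.Analysis.Calculus.ContDiff.RCLike
import Mathlib.Analysis.Convex.PathConnected
import Mathlib.Geometry.Manifold.IsManifold.InteriorBoundary
import Mathlib.Geometry.Manifold.ContMDiff.Atlas
import Mathlib.Geometry.Manifold.ContMDiff.NormedSpace
import HarnessLib

/-!
# The complement of a closed set of codimension `≥ 2` in a connected manifold is connected

Topic `Literature/Topology/FourManifolds` (fact seat
`provefact-Literature.SPC4.exists_diffeomorph_comp_incl_eq`, leaf C "the boundary of a
`4`-dimensional `1`-handlebody is connected", `OneHandlebodyBoundary.lean`, where the set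
removed is the union of the stable sets of the critical points of index `≤ 1` of a Morse
function on a `4`-manifold).  Everything here is **proved**; general position by a
Hausdorff-dimension count, with Mathlib's `dimH` API.

**The statement** (`Literature.Topology.FourManifolds.isPathConnected_compl_of_subset_iUnion_image`).  Let `M` be a
connected `C¹` manifold modelled on `I : ModelWithCorners ℝ E H` (corners allowed), `S ⊆ M` a
closed set of interior points which is covered by countably many `C¹`-images `gᵢ(Uᵢ)` of open
subsets `Uᵢ` of a parameter space `P` with `dim P + 2 ≤ dim E`.  Then `M ∖ S` is path
connected (and `S` has empty interior, `Literature.Topology.FourManifolds.interior_eq_empty_of_subset_iUnion_image`).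
This is the smooth form of the classical fact that a closed subset of (covering) dimension
`≤ n - 2` does not separate an `n`-manifold (Hurewicz–Wallman, *Dimension Theory* (1941),
Thm. IV 4 with Cor. 1 p. 48 for `ℝⁿ`); for smooth images it is the general-position remark
used throughout Morse theory, e.g. Milnor, *Lectures on the h-cobordism theorem* (1965), proof
of Thm. 8.1, p. 100 ("since `SR` and `SL'` have codimension `≥ 2` their complement is
connected" is the same count).

**Proof.**  In a chart ball `C` about a point of `S`: the image `T` of `S` has Hausdorff
dimension `≤ dim P` (`C¹` maps are locally Lipschitz, `dimH_image_le_of_locally_lipschitzOn`),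
and for `x ∈ C ∖ T` the cone `Kₓ = {x + t(s - x) | s ∈ T, t ≥ 1}` of points `z` such that the
segment `[x, z]` meets `T` is a `C¹`-image of `Uᵢ × ℝ`, of dimension `≤ dim P + 1 < dim E`; so
`Kₓ ∪ K_y ∪ T` has dense complement (`dense_compl_of_dimH_lt_finrank`) and any `z ∈ C` off it
gives a two-segment path `x → z → y` in `C ∖ T` (`Literature.Topology.FourManifolds.SmallSet.joinedIn_diff`).  Globally:
every point has an open neighbourhood `N` such that any two points of `N ∖ S` are joined in
`M ∖ S` (chart balls at points of `S`; path-connected neighbourhoods inside the open set `M ∖ S`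
elsewhere, `Literature.Topology.FourManifolds.exists_isOpen_isPathConnected_subset` from the convexity of `range I`), `S` has
empty interior, and a clopen-set argument over the connected `M` joins any two points of
`M ∖ S`.

## References

* W. Hurewicz, H. Wallman, *Dimension Theory*, Princeton (1941), Ch. IV §5, Thm. IV 4 and its
  corollaries (an `(n-2)`-dimensional closed set does not separate `ℝⁿ`). [HurewiczWallman1941]
* J. Milnor, *Lectures on the h-cobordism theorem*, Princeton (1965), §8, proof of Thm. 8.1
  (codimension-`2` general position). [MilnorHCobordism1965]
-/

open scoped Manifold ContDiff Topology ENNReal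
open Set Function Filter Metric Module

noncomputable section

namespace Literature.Topology.FourManifolds

universe u

namespace SmallSet

/-! ### General position in a vector space: Hausdorff dimension counts -/

section Euclid

variable {E : Type*} [NormedAddCommGroup E] [NormedSpace ℝ E]
  {P : Type*} [NormedAddCommGroup P] [NormedSpace ℝ P] [FiniteDimensional ℝ P]

/-- A `C¹` image of an open subset of `P` has Hausdorff dimension at most `dim P` (`C¹` maps
are locally Lipschitz; Mathlib's `dimH_image_le_of_locally_lipschitzOn`). [folklore] -/
theorem dimH_image_le_finrank {f : P → E} {W : Set P} (hW : IsOpen W) (hf : ContDiffOn ℝ 1 f W) :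
    dimH (f '' W) ≤ finrank ℝ P := by
  have h1 : dimH (f '' W) ≤ dimH W := by
    refine dimH_image_le_of_locally_lipschitzOn fun x hx => ?_
    obtain ⟨K, t, ht, hK⟩ := ((hf x hx).contDiffAt (hW.mem_nhds hx)).exists_lipschitzOnWith
    exact ⟨K, t, mem_nhdsWithin_of_mem_nhds ht, hK⟩
  calc dimH (f '' W) ≤ dimH W := h1
    _ ≤ dimH (univ : Set P) := dimH_mono (subset_univ _)
    _ = finrank ℝ P := Real.dimH_univ_eq_finrank P

/-- A set covered by countably many `C¹` images of open subsets of `P` has Hausdorff dimension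
at most `dim P`. [folklore] -/
theorem dimH_le_finrank_of_subset_iUnion {ι : Type*} [Countable ι] {T : Set E} (h : ι → P → E)
    (W : ι → Set P) (hW : ∀ i, IsOpen (W i)) (hh : ∀ i, ContDiffOn ℝ 1 (h i) (W i))
    (hT : T ⊆ ⋃ i, h i '' W i) : dimH T ≤ finrank ℝ P :=
  calc dimH T ≤ dimH (⋃ i, h i '' W i) := dimH_mono hT
    _ = ⨆ i, dimH (h i '' W i) := dimH_iUnion _
    _ ≤ finrank ℝ P := iSup_le fun i => dimH_image_le_finrank (hW i) (hh i)

/-- The **cone** over `T` from `x`, beyond `T`: the points `x + t (s - x)`, `s ∈ T`, `t ≥ 1` —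
exactly the points `z` such that the segment `[x, z]` meets `T` away from `x`. [folklore] -/
def coneOver (x : E) (T : Set E) : Set E :=
  (fun q : E × ℝ => x + q.2 • (q.1 - x)) '' (T ×ˢ Ici 1)

/-- If the segment `[x, z]` meets `T` and `x ∉ T`, then `z` lies in the cone over `T` from `x`.
[folklore] -/
theorem mem_coneOver_of_mem_segment {x z s : E} {T : Set E} (hs : s ∈ segment ℝ x z)
    (hsT : s ∈ T) (hx : x ∉ T) : z ∈ coneOver x T := by
  rw [segment_eq_image'] at hs
  obtain ⟨θ, ⟨hθ0, hθ1⟩, rfl⟩ := hs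
  have hθ : θ ≠ 0 := by
    rintro rfl
    simp only [zero_smul, add_zero] at hsT
    exact hx hsT
  have hθpos : 0 < θ := lt_of_le_of_ne hθ0 (Ne.symm hθ)
  refine ⟨(x + θ • (z - x), θ⁻¹), ⟨hsT, ?_⟩, ?_⟩
  · exact (one_le_inv₀ hθpos).2 hθ1
  · simp only [add_sub_cancel_left, smul_smul, inv_mul_cancel₀ hθ, one_smul, add_sub_cancel]

/-- The cone over a countable union of `C¹` images of open subsets of `P` has Hausdorff
dimension at most `dim P + 1`: it is covered by the `C¹` images of the open sets `Wᵢ × ℝ`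
under `(w, t) ↦ x + t (hᵢ w - x)`. [folklore] -/
theorem dimH_coneOver_le {ι : Type*} [Countable ι] {T : Set E} (h : ι → P → E)
    (W : ι → Set P) (hW : ∀ i, IsOpen (W i)) (hh : ∀ i, ContDiffOn ℝ 1 (h i) (W i))
    (hT : T ⊆ ⋃ i, h i '' W i) (x : E) : dimH (coneOver x T) ≤ finrank ℝ P + 1 := by
  set F : ι → P × ℝ → E := fun i q => x + q.2 • (h i q.1 - x) with hF
  have hsub : coneOver x T ⊆ ⋃ i, F i '' (W i ×ˢ univ) := by
    rintro z ⟨⟨s, t⟩, ⟨hsT, -⟩, rfl⟩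
    obtain ⟨i, w, hw, rfl⟩ := mem_iUnion.1 (hT hsT) |>.imp fun i hi => mem_image _ _ _ |>.1 hi
    exact mem_iUnion.2 ⟨i, (w, t), ⟨hw, mem_univ _⟩, rfl⟩
  have hFd : ∀ i, ContDiffOn ℝ 1 (F i) (W i ×ˢ univ) := fun i =>
    contDiffOn_const.add (contDiffOn_snd.smul
      (((hh i).comp contDiffOn_fst fun q hq => hq.1).sub contDiffOn_const))
  have hrank : (finrank ℝ (P × ℝ) : ℝ≥0∞) = finrank ℝ P + 1 := by
    rw [Module.finrank_prod, Module.finrank_self]; push_cast; rfl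
  calc dimH (coneOver x T) ≤ dimH (⋃ i, F i '' (W i ×ˢ univ)) := dimH_mono hsub
    _ = ⨆ i, dimH (F i '' (W i ×ˢ univ)) := dimH_iUnion _
    _ ≤ finrank ℝ (P × ℝ) :=
        iSup_le fun i => dimH_image_le_finrank ((hW i).prod isOpen_univ) (hFd i)
    _ = finrank ℝ P + 1 := hrank

/-- **Two-segment paths in general position.**  Let `T ⊆ E` be covered by countably many `C¹`
images of open subsets of `P`, `dim P + 2 ≤ dim E`, and `C` an open convex set.  Any two points
of `C ∖ T` are joined by a path in `C ∖ T`: for `z ∈ C` off the cones over `T` from `x` and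
from `y` and off `T` (a set of Hausdorff dimension `< dim E`, hence with dense complement), the
segments `[x, z]` and `[z, y]` lie in `C ∖ T`. [cite: HurewiczWallman1941, Ch. IV §5, Thm. IV 4 and Cor. 1] -/
theorem joinedIn_diff [FiniteDimensional ℝ E] (hdim : finrank ℝ P + 2 ≤ finrank ℝ E) {ι : Type*} [Countable ι]
    {T : Set E} (h : ι → P → E) (W : ι → Set P) (hW : ∀ i, IsOpen (W i))
    (hh : ∀ i, ContDiffOn ℝ 1 (h i) (W i)) (hT : T ⊆ ⋃ i, h i '' W i)
    {C : Set E} (hC : Convex ℝ C) (hCo : IsOpen C) {x y : E} (hx : x ∈ C \ T) (hy : y ∈ C \ T) :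
    JoinedIn (C \ T) x y := by
  -- the bad set and its dimension
  set B : Set E := coneOver x T ∪ coneOver y T ∪ T with hB
  have hBdim : dimH B < finrank ℝ E := by
    have h1 := dimH_coneOver_le h W hW hh hT x
    have h2 := dimH_coneOver_le h W hW hh hT y
    have h3 := dimH_le_finrank_of_subset_iUnion h W hW hh hT
    have hlt : ((finrank ℝ P : ℝ≥0∞) + 1) < finrank ℝ E := by
      have : (finrank ℝ P + 1 : ℕ) < finrank ℝ E := by omega
      exact_mod_cast this
    rw [hB, dimH_union, dimH_union]
    refine max_lt (max_lt (lt_of_le_of_lt h1 hlt) (lt_of_le_of_lt h2 hlt)) ?_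
    exact lt_of_le_of_lt h3 (lt_of_le_of_lt (by exact_mod_cast Nat.le_succ _) hlt)
  obtain ⟨z, hzB, hzC⟩ := (dense_compl_of_dimH_lt_finrank hBdim).exists_mem_open hCo ⟨x, hx.1⟩
  simp only [hB, mem_compl_iff, mem_union, not_or] at hzB
  obtain ⟨⟨hzx, hzy⟩, hzT⟩ := hzB
  -- the two segments
  have hseg₁ : segment ℝ x z ⊆ C \ T := fun s hs =>
    ⟨hC.segment_subset hx.1 hzC hs, fun hsT => hzx (mem_coneOver_of_mem_segment hs hsT hx.2)⟩
  have hseg₂ : segment ℝ z y ⊆ C \ T := fun s hs => by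
    rw [segment_symm] at hs
    exact ⟨hC.segment_subset hy.1 hzC hs, fun hsT => hzy (mem_coneOver_of_mem_segment hs hsT hy.2)⟩
  exact (JoinedIn.of_segment_subset hseg₁).trans (JoinedIn.of_segment_subset hseg₂)

/-- A set covered by countably many `C¹` images of open subsets of `P`, `dim P < dim E`, has
dense complement. [folklore] -/
theorem dense_compl [FiniteDimensional ℝ E] (hdim : finrank ℝ P < finrank ℝ E) {ι : Type*} [Countable ι]
    {T : Set E} (h : ι → P → E) (W : ι → Set P) (hW : ∀ i, IsOpen (W i))
    (hh : ∀ i, ContDiffOn ℝ 1 (h i) (W i)) (hT : T ⊆ ⋃ i, h i '' W i) : Dense Tᶜ :=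
  dense_compl_of_dimH_lt_finrank
    (lt_of_le_of_lt (dimH_le_finrank_of_subset_iUnion h W hW hh hT) (by exact_mod_cast hdim))

end Euclid

end SmallSet

/-! ### On a manifold -/

section LocPathConnected

variable {E : Type*} [NormedAddCommGroup E] [NormedSpace ℝ E] {H : Type*} [TopologicalSpace H]

/-- **Manifolds are locally path connected, by convexity of the model**: every point of an
open set `W` has a path-connected open neighbourhood inside `W` — the preimage under the
extended chart of a small ball, which is the image of the convex set `ball ∩ range I` under
the inverse chart (`ModelWithCorners.convex_range`). [folklore] -/
theorem exists_isOpen_isPathConnected_subset (I : ModelWithCorners ℝ E H) {M : Type u}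
    [TopologicalSpace M] [ChartedSpace H M] {W : Set M} (hW : IsOpen W) {x : M} (hx : x ∈ W) :
    ∃ N : Set M, IsOpen N ∧ x ∈ N ∧ N ⊆ W ∧ IsPathConnected N := by
  have h2 : (extChartAt I x).symm ⁻¹' W ∈ 𝓝 (extChartAt I x x) :=
    (continuousAt_extChartAt_symm x).preimage_mem_nhds (by rw [extChartAt_to_inv]; exact hW.mem_nhds hx)
  set e := extChartAt I x with he
  -- a ball whose trace on `range I` lies in the chart target and is mapped into `W`
  have h1 : e.target ∈ 𝓝[range I] e x := extChartAt_target_mem_nhdsWithin x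
  obtain ⟨u, hu, huo, hxu⟩ : ∃ u, u ∩ range I ⊆ e.target ∧ IsOpen u ∧ e x ∈ u := by
    obtain ⟨u, huo, hxu, hu⟩ := mem_nhdsWithin.1 h1
    exact ⟨u, hu, huo, hxu⟩
  obtain ⟨r, hr, hball⟩ : ∃ r > 0, ball (e x) r ⊆ u ∩ e.symm ⁻¹' W :=
    Metric.mem_nhds_iff.1 (inter_mem (huo.mem_nhds hxu) h2)
  set N : Set M := e.source ∩ e ⁻¹' ball (e x) r with hN
  have htarget : ball (e x) r ∩ range I ⊆ e.target := fun z hz => hu ⟨(hball hz.1).1, hz.2⟩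
  have hNeq : N = e.symm '' (ball (e x) r ∩ range I) := by
    apply Subset.antisymm
    · rintro a ⟨ha, hab⟩
      refine ⟨e a, ⟨hab, extChartAt_target_subset_range x (e.map_source ha)⟩, e.left_inv ha⟩
    · rintro _ ⟨z, hz, rfl⟩
      refine ⟨e.map_target (htarget hz), ?_⟩
      show e (e.symm z) ∈ ball (e x) r
      rw [e.right_inv (htarget hz)]; exact hz.1
  refine ⟨N, isOpen_extChartAt_preimage' x isOpen_ball, ⟨mem_extChartAt_source x, mem_ball_self hr⟩,
    ?_, ?_⟩
  · rintro a ⟨ha, hab⟩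
    have := (hball hab).2
    simpa only [mem_preimage, e.left_inv ha] using this
  · rw [hNeq]
    refine IsPathConnected.image' ?_ ((continuousOn_extChartAt_symm x).mono htarget)
    exact ((convex_ball _ _).inter I.convex_range).isPathConnected
      ⟨e x, mem_ball_self hr, mem_range_self _⟩

end LocPathConnected

section Manifold

variable {E : Type*} [NormedAddCommGroup E] [NormedSpace ℝ E] [FiniteDimensional ℝ E]
  {H : Type*} [TopologicalSpace H] {I : ModelWithCorners ℝ E H}
  {M : Type u} [TopologicalSpace M] [ChartedSpace H M] [IsManifold I 1 M]
  {P : Type*} [NormedAddCommGroup P] [NormedSpace ℝ P] [FiniteDimensional ℝ P]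

/-- **Chart balls about interior points, in general position with respect to `S`.**  Let
`S ⊆ M` be covered by countably many `C¹` images `gᵢ(Uᵢ)` of open subsets of `P`,
`dim P + 2 ≤ dim E`, and `x` an interior point.  Inside any neighbourhood of `x` there is an
open neighbourhood `N` (a chart ball) such that `N ∖ S ≠ ∅` and any two points of `N ∖ S` are
joined by a path in `M ∖ S` (the chart image of `S` is again such a countable union, and
`Literature.Topology.FourManifolds.SmallSet.joinedIn_diff` applies in the ball). [cite: HurewiczWallman1941, Ch. IV §5, Thm. IV 4 and Cor. 1] -/
theorem exists_nhds_joinedIn_compl (hdim : finrank ℝ P + 2 ≤ finrank ℝ E) {S : Set M}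
    {ι : Type*} [Countable ι] (g : ι → P → M) (U : ι → Set P) (hU : ∀ i, IsOpen (U i))
    (hg : ∀ i, ContMDiffOn 𝓘(ℝ, P) I 1 (g i) (U i)) (hS : S ⊆ ⋃ i, g i '' U i) {x : M}
    (hx : I.IsInteriorPoint x) {V : Set M} (hV : V ∈ 𝓝 x) :
    ∃ N : Set M, IsOpen N ∧ x ∈ N ∧ N ⊆ V ∧ (N \ S).Nonempty ∧
      ∀ a ∈ N \ S, ∀ b ∈ N \ S, JoinedIn Sᶜ a b := by
  have h2 : (extChartAt I x).symm ⁻¹' V ∈ 𝓝 (extChartAt I x x) :=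
    (continuousAt_extChartAt_symm x).preimage_mem_nhds (by rw [extChartAt_to_inv]; exact hV)
  set e := extChartAt I x with he
  -- the chart ball
  have h1 : interior e.target ∈ 𝓝 (e x) := isOpen_interior.mem_nhds (I.isInteriorPoint_iff.1 hx)
  obtain ⟨r, hr, hball⟩ : ∃ r > 0, ball (e x) r ⊆ interior e.target ∩ e.symm ⁻¹' V :=
    Metric.mem_nhds_iff.1 (inter_mem h1 h2)
  have htarget : ball (e x) r ⊆ e.target := fun z hz => interior_subset (hball hz).1
  set C : Set E := ball (e x) r with hC
  set N : Set M := e.source ∩ e ⁻¹' C with hN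
  -- the chart image of `S` and its parametrisation
  set T : Set E := e.target ∩ e.symm ⁻¹' S with hT
  set W : ι → Set P := fun i => U i ∩ g i ⁻¹' e.source with hW
  set h : ι → P → E := fun i w => e (g i w) with hh
  have hWo : ∀ i, IsOpen (W i) := fun i =>
    (hg i).continuousOn.isOpen_inter_preimage (hU i) (isOpen_extChartAt_source x)
  have hhd : ∀ i, ContDiffOn ℝ 1 (h i) (W i) := fun i => by
    have h' : ContMDiffOn 𝓘(ℝ, P) 𝓘(ℝ, E) 1 (h i) (W i) := by
      refine (contMDiffOn_extChartAt (n := 1) (x := x)).comp ((hg i).mono inter_subset_left)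
        fun w hw => ?_
      rw [← extChartAt_source I]; exact hw.2
    exact contMDiffOn_iff_contDiffOn.1 h'
  have hTsub : T ⊆ ⋃ i, h i '' W i := by
    rintro z ⟨hzt, hzS⟩
    obtain ⟨i, hi⟩ := mem_iUnion.1 (hS hzS)
    obtain ⟨w, hw, hwz⟩ := hi
    refine mem_iUnion.2 ⟨i, w, ⟨hw, ?_⟩, ?_⟩
    · show g i w ∈ e.source
      rw [hwz]; exact e.map_target hzt
    · show e (g i w) = z
      rw [hwz]; exact e.right_inv hzt
  -- points of `N ∖ S` read in the chart
  have hmemC : ∀ a ∈ N \ S, e a ∈ C \ T := fun a ha =>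
    ⟨ha.1.2, fun h' => ha.2 (by simpa only [mem_preimage, e.left_inv ha.1.1] using h'.2)⟩
  have hsymm_sub : e.symm '' (C \ T) ⊆ Sᶜ := by
    rintro _ ⟨z, ⟨hzC, hzT⟩, rfl⟩ hzS
    exact hzT ⟨htarget hzC, hzS⟩
  refine ⟨N, isOpen_extChartAt_preimage' x isOpen_ball, ⟨mem_extChartAt_source x, mem_ball_self hr⟩,
    ?_, ?_, fun a ha b hb => ?_⟩
  · rintro a ⟨ha, haC⟩
    simpa only [mem_preimage, e.left_inv ha] using (hball haC).2
  · -- `C ∖ T ≠ ∅` by density of `Tᶜ`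
    have hdim' : finrank ℝ P < finrank ℝ E := by omega
    obtain ⟨z, hzT, hzC⟩ :=
      (SmallSet.dense_compl hdim' h W hWo hhd hTsub).exists_mem_open isOpen_ball ⟨e x, mem_ball_self hr⟩
    refine ⟨e.symm z, ⟨e.map_target (htarget hzC), ?_⟩, fun hzS => hzT ⟨htarget hzC, hzS⟩⟩
    show e (e.symm z) ∈ C
    rw [e.right_inv (htarget hzC)]; exact hzC
  · have hj : JoinedIn (C \ T) (e a) (e b) :=
      SmallSet.joinedIn_diff hdim h W hWo hhd hTsub (convex_ball _ _) isOpen_ball (hmemC a ha)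
        (hmemC b hb)
    have hj' := hj.map_continuousOn ((continuousOn_extChartAt_symm x).mono fun z hz => htarget hz.1)
    rw [e.left_inv ha.1.1, e.left_inv hb.1.1] at hj'
    exact hj'.mono hsymm_sub

/-- **A set of interior points covered by countably many `C¹` images of a parameter space of
dimension `≤ dim M - 2` has empty interior.** [cite: HurewiczWallman1941, Ch. IV §5, Thm. IV 4 and Cor. 1] -/
theorem interior_eq_empty_of_subset_iUnion_image (hdim : finrank ℝ P + 2 ≤ finrank ℝ E)
    {S : Set M} (hSint : ∀ x ∈ S, I.IsInteriorPoint x) {ι : Type*} [Countable ι]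
    (g : ι → P → M) (U : ι → Set P) (hU : ∀ i, IsOpen (U i))
    (hg : ∀ i, ContMDiffOn 𝓘(ℝ, P) I 1 (g i) (U i)) (hS : S ⊆ ⋃ i, g i '' U i) :
    interior S = ∅ := by
  by_contra hne
  obtain ⟨x, hx⟩ := nonempty_iff_ne_empty.2 hne
  obtain ⟨N, -, -, hNV, ⟨a, haN, haS⟩, -⟩ :=
    exists_nhds_joinedIn_compl hdim g U hU hg hS (hSint x (interior_subset hx))
      (isOpen_interior.mem_nhds hx)
  exact haS (interior_subset (hNV haN))

/-- **The complement of a closed set of codimension `≥ 2` is path connected.**  Let `M` be a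
connected `C¹` manifold (model with corners `I` on `E`), `S ⊆ M` a closed set of interior
points covered by countably many `C¹` images `gᵢ(Uᵢ)` of open subsets `Uᵢ` of a parameter
space `P` with `dim P + 2 ≤ dim E`.  Then `M ∖ S` is path connected (Hurewicz–Wallman (1941),
Thm. IV 4: closed sets of dimension `≤ n - 2` do not separate; here in the smooth,
general-position form).  Proof: neighbourhoods `N_x` as in `exists_nhds_joinedIn_compl` (at
points of `S`) or path connected inside the open set `M ∖ S` (elsewhere); the set of `x` such
that `N_x ∖ S` is joined to a fixed base point is clopen, hence everything. [cite: HurewiczWallman1941, Ch. IV §5, Thm. IV 4 and Cor. 1] -/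
theorem isPathConnected_compl_of_subset_iUnion_image [ConnectedSpace M]
    (hdim : finrank ℝ P + 2 ≤ finrank ℝ E) {S : Set M} (hS : IsClosed S)
    (hSint : ∀ x ∈ S, I.IsInteriorPoint x) {ι : Type*} [Countable ι]
    (g : ι → P → M) (U : ι → Set P) (hU : ∀ i, IsOpen (U i))
    (hg : ∀ i, ContMDiffOn 𝓘(ℝ, P) I 1 (g i) (U i)) (hSsub : S ⊆ ⋃ i, g i '' U i) :
    IsPathConnected Sᶜ := by
  have hint : interior S = ∅ := interior_eq_empty_of_subset_iUnion_image hdim hSint g U hU hg hSsub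
  -- good neighbourhoods about every point
  have key : ∀ x : M, ∃ N : Set M, IsOpen N ∧ x ∈ N ∧ (N \ S).Nonempty ∧
      ∀ a ∈ N \ S, ∀ b ∈ N \ S, JoinedIn Sᶜ a b := fun x => by
    by_cases hxS : x ∈ S
    · obtain ⟨N, hNo, hxN, -, hNne, hNj⟩ :=
        exists_nhds_joinedIn_compl hdim g U hU hg hSsub (hSint x hxS) univ_mem
      exact ⟨N, hNo, hxN, hNne, hNj⟩
    · obtain ⟨N, hNo, hxN, hNsub, hNpc⟩ :=
        exists_isOpen_isPathConnected_subset I hS.isOpen_compl (mem_compl hxS)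
      refine ⟨N, hNo, hxN, ⟨x, hxN, hxS⟩, fun a ha b hb => ?_⟩
      exact (hNpc.joinedIn a ha.1 b hb.1).mono hNsub
  choose N hNo hxN hNne hNj using key
  -- overlapping neighbourhoods overlap off `S`
  have hover : ∀ x y, (N x ∩ N y).Nonempty → ((N x ∩ N y) \ S).Nonempty := fun x y hxy => by
    by_contra h
    rw [not_nonempty_iff_eq_empty, sdiff_eq_empty] at h
    have : N x ∩ N y ⊆ interior S := interior_maximal h ((hNo x).inter (hNo y))
    rw [hint] at this
    exact not_nonempty_iff_eq_empty.2 (subset_empty_iff.1 this) hxy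
  -- a base point
  obtain ⟨x₀⟩ := (inferInstance : Nonempty M)
  obtain ⟨a, ha⟩ := hNne x₀
  have haS : a ∈ Sᶜ := ha.2
  refine ⟨a, haS, fun {b} hb => ?_⟩
  set Q : Set M := {x | ∀ c ∈ N x \ S, JoinedIn Sᶜ a c} with hQ
  have hQopen : IsOpen Q := by
    refine isOpen_iff_forall_mem_open.2 fun x hx => ⟨N x, fun x' hx' => ?_, hNo x, hxN x⟩
    obtain ⟨d, ⟨hdx, hdx'⟩, hdS⟩ := hover x x' ⟨x', hx', hxN x'⟩
    intro c hc
    exact (hx d ⟨hdx, hdS⟩).trans (hNj x' d ⟨hdx', hdS⟩ c hc)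
  have hQclosed : IsClosed Q := by
    refine ⟨isOpen_iff_forall_mem_open.2 fun x hx => ⟨N x, fun x' hx' hx'Q => hx ?_, hNo x, hxN x⟩⟩
    obtain ⟨d, ⟨hdx, hdx'⟩, hdS⟩ := hover x x' ⟨x', hx', hxN x'⟩
    intro c hc
    exact (hx'Q d ⟨hdx', hdS⟩).trans (hNj x d ⟨hdx, hdS⟩ c hc)
  have haQ : a ∈ Q := fun c hc => hNj a a ⟨hxN a, haS⟩ c hc
  have hQuniv : Q = univ := IsClopen.eq_univ ⟨hQclosed, hQopen⟩ ⟨a, haQ⟩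
  have hbQ : b ∈ Q := by rw [hQuniv]; exact mem_univ b
  exact hbQ b ⟨hxN b, hb⟩

/-- **The complement of a closed set of codimension `≥ 2` in a connected manifold is
connected** (corollary of `isPathConnected_compl_of_subset_iUnion_image`). [cite: HurewiczWallman1941, Ch. IV §5, Thm. IV 4 and Cor. 1] -/
theorem isConnected_compl_of_subset_iUnion_image [ConnectedSpace M]
    (hdim : finrank ℝ P + 2 ≤ finrank ℝ E) {S : Set M} (hS : IsClosed S)
    (hSint : ∀ x ∈ S, I.IsInteriorPoint x) {ι : Type*} [Countable ι]
    (g : ι → P → M) (U : ι → Set P) (hU : ∀ i, IsOpen (U i))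
    (hg : ∀ i, ContMDiffOn 𝓘(ℝ, P) I 1 (g i) (U i)) (hSsub : S ⊆ ⋃ i, g i '' U i) :
    IsConnected Sᶜ :=
  (isPathConnected_compl_of_subset_iUnion_image hdim hS hSint g U hU hg hSsub).isConnected

end Manifold

end Literature.Topology.FourManifolds
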